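import Summits.CriticalPhenomena.PercolationContinuityZ3.Theorems.Transplant.PlanarSkeletonFrmFromDefs
import Summits.CriticalPhenomena.PercolationContinuityZ3.Theorems.Transplant.SkelFrmFromBChoiceRootReadWidthY
import Summits.CriticalPhenomena.PercolationContinuityZ3.Theorems.Transplant.SkelFrmBChoiceRootReadWidthY
import Summits.CriticalPhenomena.PercolationContinuityZ3.Theorems.Transplant.SkelFrmFromBChoiceArrivalYW
import Summits.CriticalPhenomena.PercolationContinuityZ3.Theorems.Transplant.SkelFrmBChoiceArrivalYW
import HarnessLib
import Summits.CriticalPhenomena.PercolationContinuityZ3.Theorems.Transplant.SkelFrmBChoiceRootReadRowsY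
/-!
# U-WAVE PORT (RULING D-U, lead g21 2026-08-26; WAVE-U-MANIFEST v3.0 row «SkelFrmBChoiceRootReadRowsY» ↦ «SkelFrmFromBChoiceRootReadRowsY») of the tree module
# `Transplant/SkelFrmBChoiceRootReadRowsY` onto the carrier `PlanarSkeletonFrmFrom` (frames only, cylinders connected from width `ℓ₀` on)

ORIGINAL TITLE: N2 (frames-only node `SamePDropOfSkeletonFrm₁`, OPEN) — (ζ″) ledger, (R) column input (p3-g18 asks 2026-08-23T15:56:57Z/16:24:36Z): **THE ROOT READING ROWS,

builds on p205010 (kernel theorem, internal audit signed; external expert review pending) — nothing in this file uses p205010; NOTHING is claimed about the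
OPEN node U `SamePDropOfSkeletonFrmFrom₁` (nor U_s / the end state).  Lane `prim-bschramm`, seat `prim-hp-8 gen 53 (U-wave port pen, family P-hp8; tool of record = p3-g26 port_u.py)`; helper file
(`--supports stmt-CriticalPhenomena-4575 --as helper`).  PORT RULES r1–r4 of RULING D-U: declaration order and proof texts are those of the original,
byte-identical except (i) the carrier token `PlanarSkeletonFrm ↦ PlanarSkeletonFrmFrom` (binders, `namespace`/`end` lines, qualified names of twinned
declarations), (ii) carrier-FREE declarations of the original (φ-level `Skelφ…` blocks and namespace-only arithmetic residents) are NOT re-declared —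
this file imports the original and `export`s the twin-free residents (POLICY T / treatment (m1)); residents whose statement mentions a twinned
constant are copied, (iii) every carrier-binding declaration keeps its explicit binder `(Φ : PlanarSkeletonFrmFrom G)` in its own signature (r2).  Docstrings and citations are the original's.  Manifest row idx 166 (level 18; flags verbatim|RESIDENTS(T:0/free:1)); filed by the hp-8 lineage under RULING M-11 (family P-hp8).
-/

open scoped Classical

noncomputable section

namespace Summit.CriticalPhenomena.PercolationContinuityZ3.Theorems.Transplant

namespace PlanarSkeletonFrmFrom

namespace NegB

open Literature.Probability.Percolation Literature.Probability.LatticeModels SimpleGraph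
open Literature.Probability.Percolation.KozmaNitzan.Cells (oth)
open SkelConc (Consts)
open Skelφ (shearUnit kgSL kgSLY kgM₁Y kgM₂Y kgE₁Y kgXY kgCtr2Y kgHw2Y kgA₁Yp kgT₁Y kgTY kgDec₁Y kgDec₂Y dS rdLo rdHi KGYRows)
open TwoAxis.Para (modulus)
open Neg

/-! ## §4 The pure-integer core of the y′ arrival rows, widened rows -/

export PlanarSkeletonFrm.NegB (arrivalY_core_wide)

/-! ## §5 (R-YA) at the tuple of record -/

section RootYA

variable (κ : Consts) {V : Type} [DecidableEq V] [Countable V] {G : SimpleGraph V} [G.LocallyFinite] (Φ : PlanarSkeletonFrmFrom G) (t : V) (p : unitInterval)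
  (D : Skelφ.StepI.DataNS V) (g f mk : ℕ)

/-- **(R-YA), ROWS (axis 1)**: the (C) y′ arrival box widened by `(s | 1)` in rows reads `20r₁ − b₁ + 1 ≤ rdLo₁ ∧ rdHi₁ ≤ 20r₁ + b₁ − 1` (`b₁ = 19·s₁`; any axis-0
corners). [this work] -/
theorem rootReadYA_rows (κ : Consts) {V : Type} [DecidableEq V] [Countable V] {G : SimpleGraph V} [G.LocallyFinite] (Φ : PlanarSkeletonFrmFrom G) (t : V) (p : unitInterval) (D : Skelφ.StepI.DataNS V) (g : ℕ) (f : ℕ) (mk : ℕ) (hKq : 5 ≤ Neg.Kq κ) (hN : EqNumL κ Φ t p D g f) (hg : gFloorKG κ Φ t p D mk ≤ g) (hg2 : 40 * Neg.K κ * KS0.R'0 κ Φ t p D mk ≤ g) :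
    20 * (((fcellsA κ Φ t p D g f).r 1 : ℕ) : ℤ) - ((BSlot.small3 κ Φ t p D g f 1 : ℕ) : ℤ) + 1 ≤ rdLo (Aof κ) (nL κ Φ t p D g f) (hL κ Φ t p D g f) (vL κ Φ t p D g f) (vβL κ Φ t p D g f) (prFA κ Φ t p D g f).c₀ (prFA κ Φ t p D g f).c₁ (prFA κ Φ t p D g f).D (![arrLoY3 κ Φ t p D g f mk 0 - 2 * (nL κ Φ t p D g f : ℤ), arrLoY3 κ Φ t p D g f mk 1 - kgSL (nL κ Φ t p D g f) (ℓL κ Φ t p D g f) (hL κ Φ t p D g f)] : Site 2) (![arrHiY3 κ Φ t p D g f mk 0 + (nL κ Φ t p D g f : ℤ), arrHiY3 κ Φ t p D g f mk 1 + 1] : Site 2) 1 ∧ rdHi (Aof κ) (nL κ Φ t p D g f) (hL κ Φ t p D g f) (vL κ Φ t p D g f) (vβL κ Φ t p D g f) (prFA κ Φ t p D g f).c₀ (prFA κ Φ t p D g f).c₁ (prFA κ Φ t p D g f).D (![arrLoY3 κ Φ t p D g f mk 0 - 2 * (nL κ Φ t p D g f : ℤ), arrLoY3 κ Φ t p D g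 f mk 1 - kgSL (nL κ Φ t p D g f) (ℓL κ Φ t p D g f) (hL κ Φ t p D g f)] : Site 2) (![arrHiY3 κ Φ t p D g f mk 0 + (nL κ Φ t p D g f : ℤ), arrHiY3 κ Φ t p D g f mk 1 + 1] : Site 2) 1 ≤ 20 * (((fcellsA κ Φ t p D g f).r 1 : ℕ) : ℤ) + ((BSlot.small3 κ Φ t p D g f 1 : ℕ) : ℤ) - 1 := by
  obtain ⟨-, hsc1, hn1, -, hDp, hm, -, -, hkq, -⟩ := hsc_Q κ Φ t p D g f hN
  obtain ⟨-, hs40, hbig, hR1, hK40, -⟩ := valsQ_floor κ Φ t p D g f mk hN hg hg2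
  have hUs := UsL_le_modulus κ Φ t p D g f hN
  obtain ⟨hpy1, hpy2⟩ := pitchY_floor_W κ Φ t p D g f hN
  obtain ⟨ht1, ht2⟩ := tgtY0_two_mul_W κ Φ t p D g f mk
  obtain ⟨hfar, htgt⟩ := farY_spec_W κ Φ t p D g f mk hKq hN hg hg2
  have hP1 := Skelφ.natDiv_le_kgSLY hn1 (ℓL κ Φ t p D g f) (hL κ Φ t p D g f)
  rw [kgSLY_eq_kgSL] at hP1
  have hP0nat : (((nL κ Φ t p D g f) * (ℓL κ Φ t p D g f) / (shearUnit (nL κ Φ t p D g f) (hL κ Φ t p D g f)) : ℕ) : ℤ) = (((nL κ Φ t p D g f) : ℕ) : ℤ) * (ℓL κ Φ t p D g f) / ((shearUnit (nL κ Φ t p D g f) (hL κ Φ t p D g f)) : ℕ) := by push_cast; rfl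
  have hRR : ((KS0.R'0 κ Φ t p D mk : ℕ) : ℤ) = (((kgR κ Φ t p D mk) : ℕ) : ℤ) := rfl
  rw [hRR] at hs40 hR1
  have hU : (0 : ℤ) < ((shearUnit (nL κ Φ t p D g f) (hL κ Φ t p D g f)) : ℕ) := Skelφ.shearUnit_pos hn1 _
  have hU1 : (1 : ℤ) ≤ ((shearUnit (nL κ Φ t p D g f) (hL κ Φ t p D g f)) : ℕ) := by linarith
  have hs1one : (1 : ℤ) ≤ ((((fcellsA κ Φ t p D g f).s 1 : ℕ) : ℤ)) := by exact_mod_cast (fcellsA κ Φ t p D g f).hs 1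
  -- the box rows
  obtain ⟨-, -, elo1, ehi1⟩ := arrY3_apply κ Φ t p D g f mk
  rw [kgSLY_eq_kgSL] at elo1 ehi1
  have hlo : arrLoY3 κ Φ t p D g f mk 1 = arrHiY3 κ Φ t p D g f mk 1 - (((nL κ Φ t p D g f) * (ℓL κ Φ t p D g f) / (shearUnit (nL κ Φ t p D g f) (hL κ Φ t p D g f)) : ℕ) : ℤ) := by rw [elo1, ehi1, hP0nat]; push_cast; ring
  rw [← ehi1] at hfar htgt
  -- the fine-1 reading is `⌊s₁·X/Δ⌋`
  have hr1 : ((((fcellsA κ Φ t p D g f).r 1 : ℕ) : ℤ)) = 40 * ((Neg.Kq κ : ℕ) : ℤ) * ((((fcellsA κ Φ t p D g f).s 1 : ℕ) : ℤ)) := by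
    rw [PCells2.r_eq, show ((fcellsA κ Φ t p D g f).K : ℤ) = Neg.K κ by exact_mod_cast (fcellsA_K κ Φ t p D g f).1,
      show (Neg.K κ : ℤ) = 40 * ((Neg.Kq κ : ℕ) : ℤ) by exact_mod_cast Neg.K_eq κ]
  have hr1K : ((((fcellsA κ Φ t p D g f).r 1 : ℕ) : ℤ)) = (((Neg.K κ : ℕ) : ℤ)) * ((((fcellsA κ Φ t p D g f).s 1 : ℕ) : ℤ)) := by rw [PCells2.r_eq, show ((fcellsA κ Φ t p D g f).K : ℤ) = Neg.K κ by exact_mod_cast (fcellsA_K κ Φ t p D g f).1]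
  have hb1 : ((BSlot.small3 κ Φ t p D g f 1 : ℕ) : ℤ) = 19 * ((((fcellsA κ Φ t p D g f).s 1 : ℕ) : ℤ)) := by rw [(small3_eq κ Φ t p D g f).2]; push_cast; ring
  have hkq' : (0 : ℤ) < ((Neg.Kq κ : ℕ) : ℤ) := by exact_mod_cast hkq
  have hsc1' : (prFA κ Φ t p D g f).c₁ * Aof κ * (40 * ((Neg.Kq κ : ℕ) : ℤ) * (modulus (nL κ Φ t p D g f) (hL κ Φ t p D g f) (vL κ Φ t p D g f) (vβL κ Φ t p D g f))) = 40 * ((Neg.Kq κ : ℕ) : ℤ) * ((((fcellsA κ Φ t p D g f).s 1 : ℕ) : ℤ)) * (prFA κ Φ t p D g f).D := by rw [hsc1, hr1]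
  rw [Skelφ.rdLo_one, Skelφ.rdHi_one]
  simp only [Matrix.cons_val_one, Matrix.cons_val_zero]
  rw [rd1_div_eq (X := _) hDp hkq' hm hsc1', rd1_div_eq (X := _) hDp hkq' hm hsc1', hr1K, hb1]
  have hFlo' := Int.lt_mul_ediv_self_add (x := ((((fcellsA κ Φ t p D g f).s 1 : ℕ) : ℤ)) * ((((shearUnit (nL κ Φ t p D g f) (hL κ Φ t p D g f)) : ℕ) : ℤ) * (arrLoY3 κ Φ t p D g f mk 1 - kgSL (nL κ Φ t p D g f) (ℓL κ Φ t p D g f) (hL κ Φ t p D g f)))) hm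
  have hFhi := Int.mul_ediv_self_le (x := ((((fcellsA κ Φ t p D g f).s 1 : ℕ) : ℤ)) * ((((shearUnit (nL κ Φ t p D g f) (hL κ Φ t p D g f)) : ℕ) : ℤ) * (arrHiY3 κ Φ t p D g f mk 1 + 1) + (((shearUnit (nL κ Φ t p D g f) (hL κ Φ t p D g f)) : ℕ) : ℤ) - 1)) (ne_of_gt hm)
  exact arrivalY_core_wide (hU := hU1) (hUs := hUs) (hs := hbig) (hK := hK40) (hR := hR1) (hKR := hs40) (hP1 := hP1) (hpy1 := hpy1) (hpy2 := hpy2)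
    (ht1 := ht1) (ht2 := ht2) (hfar := hfar) (htgt := htgt) (hlo := hlo) (hs1 := hs1one) (hFlo' := hFlo') (hFhi := hFhi)

/-- **(R-YA), ACROSS (axis 0)**: the (C) y′ arrival box widened by `(2n_L | n_L)` along x and `(s | 1)` in rows reads `c1 − b₀ + 1 ≤ rdLo₀ ∧ rdHi₀ ≤ c1 + b₀ − 1`
(`c1 = cRvY3` = the midpoint of the unwidened box's x-reading, whose width is `≤ 95·s₀ − 1` (`rd0Y_width_3`); the widening moves the readings by `3·s₀` down /
`2·s₀` up (`rdLo_zero_widen`/`rdHi_zero_widen` with `c₀'·A·Δ = s₀·D`, `|v|·U·sL ≤ n·Δ`); `b₀ = 76·s₀`). [this work] -/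
theorem rootReadYA_across (κ : Consts) {V : Type} [DecidableEq V] [Countable V] {G : SimpleGraph V} [G.LocallyFinite] (Φ : PlanarSkeletonFrmFrom G) (t : V) (p : unitInterval) (D : Skelφ.StepI.DataNS V) (g : ℕ) (f : ℕ) (mk : ℕ) (hKq : 5 ≤ Neg.Kq κ) (hN : EqNumL κ Φ t p D g f) (hg : gFloorKG κ Φ t p D mk ≤ g) (hg2 : 40 * Neg.K κ * KS0.R'0 κ Φ t p D mk ≤ g) :
    ((cRvY3 κ Φ t p D g f mk : ℕ) : ℤ) - ((BSlot.small3 κ Φ t p D g f 0 : ℕ) : ℤ) + 1 ≤ rdLo (Aof κ) (nL κ Φ t p D g f) (hL κ Φ t p D g f) (vL κ Φ t p D g f) (vβL κ Φ t p D g f) (prFA κ Φ t p D g f).c₀ (prFA κ Φ t p D g f).c₁ (prFA κ Φ t p D g f).D (![arrLoY3 κ Φ t p D g f mk 0 - 2 * (nL κ Φ t p D g f : ℤ), arrLoY3 κ Φ t p D g f mk 1 - kgSL (nL κ Φ t p D g f) (ℓL κ Φ t p D g f) (hL κ Φ t p D g f)] : Site 2) (![arrHiY3 κ Φ t p D g f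 mk 0 + (nL κ Φ t p D g f : ℤ), arrHiY3 κ Φ t p D g f mk 1 + 1] : Site 2) 0 ∧ rdHi (Aof κ) (nL κ Φ t p D g f) (hL κ Φ t p D g f) (vL κ Φ t p D g f) (vβL κ Φ t p D g f) (prFA κ Φ t p D g f).c₀ (prFA κ Φ t p D g f).c₁ (prFA κ Φ t p D g f).D (![arrLoY3 κ Φ t p D g f mk 0 - 2 * (nL κ Φ t p D g f : ℤ), arrLoY3 κ Φ t p D g f mk 1 - kgSL (nL κ Φ t p D g f) (ℓL κ Φ t p D g f) (hL κ Φ t p D g f)] : Site 2) (![arrHiY3 κ Φ t p D g f mk 0 + (nL κ Φ t p D g f : ℤ), arrHiY3 κ Φ t p D g f mk 1 + 1] : Site 2) 0 ≤ ((cRvY3 κ Φ t p D g f mk : ℕ) : ℤ) + ((BSlot.small3 κ Φ t p D g f 0 : ℕ) : ℤ) - 1 := by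
  obtain ⟨hsc0, -, hn1, hA0, hDp, hm, hc₀, -, hkq, -⟩ := hsc_Q κ Φ t p D g f hN
  obtain ⟨-, -, hbig, -, -, -⟩ := valsQ_floor κ Φ t p D g f mk hN hg hg2
  have hUs := UsL_le_modulus κ Φ t p D g f hN
  have hv := hN.v_le
  obtain ⟨-, hsum, -, -, -⟩ := rd0Y_bounds_3 κ Φ t p D g f mk hKq hN hg hg2
  have hw := rd0Y_width_3 κ Φ t p D g f mk hKq hN hg hg2
  obtain ⟨hc, -⟩ := cRvY3_eq κ Φ t p D g f mk hKq hN hg hg2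
  have hb0 : ((BSlot.small3 κ Φ t p D g f 0 : ℕ) : ℤ) = 76 * (((fcellsA κ Φ t p D g f).s 0 : ℕ) : ℤ) := by rw [(small3_eq κ Φ t p D g f).1]; push_cast; ring
  have hs0one : (1 : ℤ) ≤ (((fcellsA κ Φ t p D g f).s 0 : ℕ) : ℤ) := by exact_mod_cast (fcellsA κ Φ t p D g f).hs 0
  -- `c₀'·A·Δ = s₀·D`
  have hr0 : (((fcellsA κ Φ t p D g f).r 0 : ℕ) : ℤ) = 40 * ((Neg.Kq κ : ℕ) : ℤ) * (((fcellsA κ Φ t p D g f).s 0 : ℕ) : ℤ) := by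
    rw [PCells2.r_eq, show ((fcellsA κ Φ t p D g f).K : ℤ) = Neg.K κ by exact_mod_cast (fcellsA_K κ Φ t p D g f).1,
      show (Neg.K κ : ℤ) = 40 * ((Neg.Kq κ : ℕ) : ℤ) by exact_mod_cast Neg.K_eq κ]
  have e0 : (prFA κ Φ t p D g f).c₀ * Aof κ * modulus (nL κ Φ t p D g f) (hL κ Φ t p D g f) (vL κ Φ t p D g f) (vβL κ Φ t p D g f) = (((fcellsA κ Φ t p D g f).s 0 : ℕ) : ℤ) * (prFA κ Φ t p D g f).D := by
    rw [hr0] at hsc0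
    have h' : (40 * ((Neg.Kq κ : ℕ) : ℤ)) * ((prFA κ Φ t p D g f).c₀ * Aof κ * modulus (nL κ Φ t p D g f) (hL κ Φ t p D g f) (vL κ Φ t p D g f) (vβL κ Φ t p D g f)) = (40 * ((Neg.Kq κ : ℕ) : ℤ)) * ((((fcellsA κ Φ t p D g f).s 0 : ℕ) : ℤ) * (prFA κ Φ t p D g f).D) := by
      linear_combination hsc0
    have h40 : (40 * ((Neg.Kq κ : ℕ) : ℤ)) ≠ 0 := by positivity
    exact mul_left_cancel₀ h40 h'
  -- the shear spread of the extra rows: `|v|·U·sL ≤ n·Δ`, `|v|·U ≤ n·Δ`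
  have hU0 : (0 : ℤ) ≤ ((shearUnit (nL κ Φ t p D g f) (hL κ Φ t p D g f) : ℕ) : ℤ) := by positivity
  have hn0 : (0 : ℤ) ≤ (nL κ Φ t p D g f : ℤ) := by positivity
  have hs0 : (0 : ℤ) ≤ kgSL (nL κ Φ t p D g f) (ℓL κ Φ t p D g f) (hL κ Φ t p D g f) := by linarith
  have hvUs : |vL κ Φ t p D g f| * (((shearUnit (nL κ Φ t p D g f) (hL κ Φ t p D g f) : ℕ) : ℤ) * kgSL (nL κ Φ t p D g f) (ℓL κ Φ t p D g f) (hL κ Φ t p D g f)) ≤ (nL κ Φ t p D g f : ℤ) * modulus (nL κ Φ t p D g f) (hL κ Φ t p D g f) (vL κ Φ t p D g f) (vβL κ Φ t p D g f) :=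
    calc |vL κ Φ t p D g f| * (((shearUnit (nL κ Φ t p D g f) (hL κ Φ t p D g f) : ℕ) : ℤ) * kgSL (nL κ Φ t p D g f) (ℓL κ Φ t p D g f) (hL κ Φ t p D g f)) ≤ (nL κ Φ t p D g f : ℤ) * (((shearUnit (nL κ Φ t p D g f) (hL κ Φ t p D g f) : ℕ) : ℤ) * kgSL (nL κ Φ t p D g f) (ℓL κ Φ t p D g f) (hL κ Φ t p D g f)) := mul_le_mul_of_nonneg_right hv (mul_nonneg hU0 hs0)
      _ ≤ (nL κ Φ t p D g f : ℤ) * modulus (nL κ Φ t p D g f) (hL κ Φ t p D g f) (vL κ Φ t p D g f) (vβL κ Φ t p D g f) := mul_le_mul_of_nonneg_left hUs hn0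
  have hUΔ : ((shearUnit (nL κ Φ t p D g f) (hL κ Φ t p D g f) : ℕ) : ℤ) ≤ modulus (nL κ Φ t p D g f) (hL κ Φ t p D g f) (vL κ Φ t p D g f) (vβL κ Φ t p D g f) := le_trans (le_mul_of_one_le_right hU0 (by linarith)) hUs
  have hvU : |vL κ Φ t p D g f| * ((shearUnit (nL κ Φ t p D g f) (hL κ Φ t p D g f) : ℕ) : ℤ) ≤ (nL κ Φ t p D g f : ℤ) * modulus (nL κ Φ t p D g f) (hL κ Φ t p D g f) (vL κ Φ t p D g f) (vβL κ Φ t p D g f) :=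
    calc |vL κ Φ t p D g f| * ((shearUnit (nL κ Φ t p D g f) (hL κ Φ t p D g f) : ℕ) : ℤ) ≤ (nL κ Φ t p D g f : ℤ) * ((shearUnit (nL κ Φ t p D g f) (hL κ Φ t p D g f) : ℕ) : ℤ) := mul_le_mul_of_nonneg_right hv hU0
      _ ≤ (nL κ Φ t p D g f : ℤ) * modulus (nL κ Φ t p D g f) (hL κ Φ t p D g f) (vL κ Φ t p D g f) (vβL κ Φ t p D g f) := mul_le_mul_of_nonneg_left hUΔ hn0
  have hT1 : vL κ Φ t p D g f * (((shearUnit (nL κ Φ t p D g f) (hL κ Φ t p D g f) : ℕ) : ℤ) * (arrLoY3 κ Φ t p D g f mk 1 - kgSL (nL κ Φ t p D g f) (ℓL κ Φ t p D g f) (hL κ Φ t p D g f))) ≤ max (vL κ Φ t p D g f * (((shearUnit (nL κ Φ t p D g f) (hL κ Φ t p D g f) : ℕ) : ℤ) * arrLoY3 κ Φ t p D g f mk 1)) (vL κ Φ t p D g f * (((shearUnit (nL κ Φ t p D g f) (hL κ Φ t p D g f) : ℕ) : ℤ) * arrHiY3 κ Φ t p D g f mk 1 + ((shearUnit (nL κ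 Φ t p D g f) (hL κ Φ t p D g f) : ℕ) : ℤ) - 1)) + (nL κ Φ t p D g f : ℤ) * modulus (nL κ Φ t p D g f) (hL κ Φ t p D g f) (vL κ Φ t p D g f) (vβL κ Φ t p D g f) := by
    have e1 : vL κ Φ t p D g f * (((shearUnit (nL κ Φ t p D g f) (hL κ Φ t p D g f) : ℕ) : ℤ) * (arrLoY3 κ Φ t p D g f mk 1 - kgSL (nL κ Φ t p D g f) (ℓL κ Φ t p D g f) (hL κ Φ t p D g f))) = vL κ Φ t p D g f * (((shearUnit (nL κ Φ t p D g f) (hL κ Φ t p D g f) : ℕ) : ℤ) * arrLoY3 κ Φ t p D g f mk 1) + (-vL κ Φ t p D g f) * (((shearUnit (nL κ Φ t p D g f) (hL κ Φ t p D g f) : ℕ) : ℤ) * kgSL (nL κ Φ t p D g f) (ℓL κ Φ t p D g f) (hL κ Φ t p D g f)) := by ring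
    have h2 : (-vL κ Φ t p D g f) * (((shearUnit (nL κ Φ t p D g f) (hL κ Φ t p D g f) : ℕ) : ℤ) * kgSL (nL κ Φ t p D g f) (ℓL κ Φ t p D g f) (hL κ Φ t p D g f)) ≤ |vL κ Φ t p D g f| * (((shearUnit (nL κ Φ t p D g f) (hL κ Φ t p D g f) : ℕ) : ℤ) * kgSL (nL κ Φ t p D g f) (ℓL κ Φ t p D g f) (hL κ Φ t p D g f)) := mul_le_mul_of_nonneg_right (neg_le_abs _) (mul_nonneg hU0 hs0)
    rw [e1]; linarith [le_max_left (vL κ Φ t p D g f * (((shearUnit (nL κ Φ t p D g f) (hL κ Φ t p D g f) : ℕ) : ℤ) * arrLoY3 κ Φ t p D g f mk 1)) (vL κ Φ t p D g f * (((shearUnit (nL κ Φ t p D g f) (hL κ Φ t p D g f) : ℕ) : ℤ) * arrHiY3 κ Φ t p D g f mk 1 + ((shearUnit (nL κ Φ t p D g f) (hL κ Φ t p D g f) : ℕ) : ℤ) - 1))]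
  have hT2 : vL κ Φ t p D g f * (((shearUnit (nL κ Φ t p D g f) (hL κ Φ t p D g f) : ℕ) : ℤ) * (arrHiY3 κ Φ t p D g f mk 1 + 1) + ((shearUnit (nL κ Φ t p D g f) (hL κ Φ t p D g f) : ℕ) : ℤ) - 1) ≤ max (vL κ Φ t p D g f * (((shearUnit (nL κ Φ t p D g f) (hL κ Φ t p D g f) : ℕ) : ℤ) * arrLoY3 κ Φ t p D g f mk 1)) (vL κ Φ t p D g f * (((shearUnit (nL κ Φ t p D g f) (hL κ Φ t p D g f) : ℕ) : ℤ) * arrHiY3 κ Φ t p D g f mk 1 + ((shearUnit (nL κ Φ t p D g f) (hL κ Φ t p D g f) : ℕ) : ℤ) - 1)) + (nL κ Φ t p D g f : ℤ) * modulus (nL κ Φ t p D g f) (hL κ Φ t p D g f) (vL κ Φ t p D g f) (vβL κ Φ t p D g f) := by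
    have e1 : vL κ Φ t p D g f * (((shearUnit (nL κ Φ t p D g f) (hL κ Φ t p D g f) : ℕ) : ℤ) * (arrHiY3 κ Φ t p D g f mk 1 + 1) + ((shearUnit (nL κ Φ t p D g f) (hL κ Φ t p D g f) : ℕ) : ℤ) - 1) = vL κ Φ t p D g f * (((shearUnit (nL κ Φ t p D g f) (hL κ Φ t p D g f) : ℕ) : ℤ) * arrHiY3 κ Φ t p D g f mk 1 + ((shearUnit (nL κ Φ t p D g f) (hL κ Φ t p D g f) : ℕ) : ℤ) - 1) + vL κ Φ t p D g f * ((shearUnit (nL κ Φ t p D g f) (hL κ Φ t p D g f) : ℕ) : ℤ) := by ring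
    have h2 : vL κ Φ t p D g f * ((shearUnit (nL κ Φ t p D g f) (hL κ Φ t p D g f) : ℕ) : ℤ) ≤ |vL κ Φ t p D g f| * ((shearUnit (nL κ Φ t p D g f) (hL κ Φ t p D g f) : ℕ) : ℤ) := mul_le_mul_of_nonneg_right (le_abs_self _) hU0
    rw [e1]; linarith [le_max_right (vL κ Φ t p D g f * (((shearUnit (nL κ Φ t p D g f) (hL κ Φ t p D g f) : ℕ) : ℤ) * arrLoY3 κ Φ t p D g f mk 1)) (vL κ Φ t p D g f * (((shearUnit (nL κ Φ t p D g f) (hL κ Φ t p D g f) : ℕ) : ℤ) * arrHiY3 κ Φ t p D g f mk 1 + ((shearUnit (nL κ Φ t p D g f) (hL κ Φ t p D g f) : ℕ) : ℤ) - 1))]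
  have hMX : max (vL κ Φ t p D g f * (((shearUnit (nL κ Φ t p D g f) (hL κ Φ t p D g f) : ℕ) : ℤ) * (arrLoY3 κ Φ t p D g f mk 1 - kgSL (nL κ Φ t p D g f) (ℓL κ Φ t p D g f) (hL κ Φ t p D g f)))) (vL κ Φ t p D g f * (((shearUnit (nL κ Φ t p D g f) (hL κ Φ t p D g f) : ℕ) : ℤ) * (arrHiY3 κ Φ t p D g f mk 1 + 1) + ((shearUnit (nL κ Φ t p D g f) (hL κ Φ t p D g f) : ℕ) : ℤ) - 1)) ≤ max (vL κ Φ t p D g f * (((shearUnit (nL κ Φ t p D g f) (hL κ Φ t p D g f) : ℕ) : ℤ) * arrLoY3 κ Φ t p D g f mk 1)) (vL κ Φ t p D g f * (((shearUnit (nL κ Φ t p D g f) (hL κ Φ t p D g f) : ℕ) : ℤ) * arrHiY3 κ Φ t p D g f mk 1 + ((shearUnit (nL κ Φ t p D g f) (hL κ Φ t p D g f) : ℕ) : ℤ) - 1)) + (nL κ Φ t p D g f : ℤ) * modulus (nL κ Φ t p D g f) (hL κ Φ t p D g f) (vL κ Φ t p D g f) (vβL κ Φ t p D g f) := max_le hT1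 hT2
  have hT3 : min (vL κ Φ t p D g f * (((shearUnit (nL κ Φ t p D g f) (hL κ Φ t p D g f) : ℕ) : ℤ) * arrLoY3 κ Φ t p D g f mk 1)) (vL κ Φ t p D g f * (((shearUnit (nL κ Φ t p D g f) (hL κ Φ t p D g f) : ℕ) : ℤ) * arrHiY3 κ Φ t p D g f mk 1 + ((shearUnit (nL κ Φ t p D g f) (hL κ Φ t p D g f) : ℕ) : ℤ) - 1)) - (nL κ Φ t p D g f : ℤ) * modulus (nL κ Φ t p D g f) (hL κ Φ t p D g f) (vL κ Φ t p D g f) (vβL κ Φ t p D g f) ≤ vL κ Φ t p D g f * (((shearUnit (nL κ Φ t p D g f) (hL κ Φ t p D g f) : ℕ) : ℤ) * (arrLoY3 κ Φ t p D g f mk 1 - kgSL (nL κ Φ t p D g f) (ℓL κ Φ t p D g f) (hL κ Φ t p D g f))) := by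
    have e1 : vL κ Φ t p D g f * (((shearUnit (nL κ Φ t p D g f) (hL κ Φ t p D g f) : ℕ) : ℤ) * (arrLoY3 κ Φ t p D g f mk 1 - kgSL (nL κ Φ t p D g f) (ℓL κ Φ t p D g f) (hL κ Φ t p D g f))) = vL κ Φ t p D g f * (((shearUnit (nL κ Φ t p D g f) (hL κ Φ t p D g f) : ℕ) : ℤ) * arrLoY3 κ Φ t p D g f mk 1) - vL κ Φ t p D g f * (((shearUnit (nL κ Φ t p D g f) (hL κ Φ t p D g f) : ℕ) : ℤ) * kgSL (nL κ Φ t p D g f) (ℓL κ Φ t p D g f) (hL κ Φ t p D g f)) := by ring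
    have h2 : vL κ Φ t p D g f * (((shearUnit (nL κ Φ t p D g f) (hL κ Φ t p D g f) : ℕ) : ℤ) * kgSL (nL κ Φ t p D g f) (ℓL κ Φ t p D g f) (hL κ Φ t p D g f)) ≤ |vL κ Φ t p D g f| * (((shearUnit (nL κ Φ t p D g f) (hL κ Φ t p D g f) : ℕ) : ℤ) * kgSL (nL κ Φ t p D g f) (ℓL κ Φ t p D g f) (hL κ Φ t p D g f)) := mul_le_mul_of_nonneg_right (le_abs_self _) (mul_nonneg hU0 hs0)
    rw [e1]; linarith [min_le_left (vL κ Φ t p D g f * (((shearUnit (nL κ Φ t p D g f) (hL κ Φ t p D g f) : ℕ) : ℤ) * arrLoY3 κ Φ t p D g f mk 1)) (vL κ Φ t p D g f * (((shearUnit (nL κ Φ t p D g f) (hL κ Φ t p D g f) : ℕ) : ℤ) * arrHiY3 κ Φ t p D g f mk 1 + ((shearUnit (nL κ Φ t p D g f) (hL κ Φ t p D g f) : ℕ) : ℤ) - 1))]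
  have hT4 : min (vL κ Φ t p D g f * (((shearUnit (nL κ Φ t p D g f) (hL κ Φ t p D g f) : ℕ) : ℤ) * arrLoY3 κ Φ t p D g f mk 1)) (vL κ Φ t p D g f * (((shearUnit (nL κ Φ t p D g f) (hL κ Φ t p D g f) : ℕ) : ℤ) * arrHiY3 κ Φ t p D g f mk 1 + ((shearUnit (nL κ Φ t p D g f) (hL κ Φ t p D g f) : ℕ) : ℤ) - 1)) - (nL κ Φ t p D g f : ℤ) * modulus (nL κ Φ t p D g f) (hL κ Φ t p D g f) (vL κ Φ t p D g f) (vβL κ Φ t p D g f) ≤ vL κ Φ t p D g f * (((shearUnit (nL κ Φ t p D g f) (hL κ Φ t p D g f) : ℕ) : ℤ) * (arrHiY3 κ Φ t p D g f mk 1 + 1) + ((shearUnit (nL κ Φ t p D g f) (hL κ Φ t p D g f) : ℕ) : ℤ) - 1) := by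
    have e1 : vL κ Φ t p D g f * (((shearUnit (nL κ Φ t p D g f) (hL κ Φ t p D g f) : ℕ) : ℤ) * (arrHiY3 κ Φ t p D g f mk 1 + 1) + ((shearUnit (nL κ Φ t p D g f) (hL κ Φ t p D g f) : ℕ) : ℤ) - 1) = vL κ Φ t p D g f * (((shearUnit (nL κ Φ t p D g f) (hL κ Φ t p D g f) : ℕ) : ℤ) * arrHiY3 κ Φ t p D g f mk 1 + ((shearUnit (nL κ Φ t p D g f) (hL κ Φ t p D g f) : ℕ) : ℤ) - 1) + vL κ Φ t p D g f * ((shearUnit (nL κ Φ t p D g f) (hL κ Φ t p D g f) : ℕ) : ℤ) := by ring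
    have h2 : -(vL κ Φ t p D g f * ((shearUnit (nL κ Φ t p D g f) (hL κ Φ t p D g f) : ℕ) : ℤ)) ≤ |vL κ Φ t p D g f| * ((shearUnit (nL κ Φ t p D g f) (hL κ Φ t p D g f) : ℕ) : ℤ) := by rw [← neg_mul]; exact mul_le_mul_of_nonneg_right (neg_le_abs _) hU0
    rw [e1]; linarith [min_le_right (vL κ Φ t p D g f * (((shearUnit (nL κ Φ t p D g f) (hL κ Φ t p D g f) : ℕ) : ℤ) * arrLoY3 κ Φ t p D g f mk 1)) (vL κ Φ t p D g f * (((shearUnit (nL κ Φ t p D g f) (hL κ Φ t p D g f) : ℕ) : ℤ) * arrHiY3 κ Φ t p D g f mk 1 + ((shearUnit (nL κ Φ t p D g f) (hL κ Φ t p D g f) : ℕ) : ℤ) - 1))]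
  have hMN : min (vL κ Φ t p D g f * (((shearUnit (nL κ Φ t p D g f) (hL κ Φ t p D g f) : ℕ) : ℤ) * arrLoY3 κ Φ t p D g f mk 1)) (vL κ Φ t p D g f * (((shearUnit (nL κ Φ t p D g f) (hL κ Φ t p D g f) : ℕ) : ℤ) * arrHiY3 κ Φ t p D g f mk 1 + ((shearUnit (nL κ Φ t p D g f) (hL κ Φ t p D g f) : ℕ) : ℤ) - 1)) - (nL κ Φ t p D g f : ℤ) * modulus (nL κ Φ t p D g f) (hL κ Φ t p D g f) (vL κ Φ t p D g f) (vβL κ Φ t p D g f) ≤ min (vL κ Φ t p D g f * (((shearUnit (nL κ Φ t p D g f) (hL κ Φ t p D g f) : ℕ) : ℤ) * (arrLoY3 κ Φ t p D g f mk 1 - kgSL (nL κ Φ t p D g f) (ℓL κ Φ t p D g f) (hL κ Φ t p D g f)))) (vL κ Φ t p D g f * (((shearUnit (nL κ Φ t p D g f) (hL κ Φ t p D g f) : ℕ) : ℤ) * (arrHiY3 κ Φ t p D g f mk 1 + 1) + ((shearUnit (nL κ Φ t p D g f) (hL κ Φ t p D g f) : ℕ) : ℤ) - 1)) := le_min hT3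 hT4
  constructor
  · have hk : (prFA κ Φ t p D g f).c₀ * (Aof κ * (3 * modulus (nL κ Φ t p D g f) (hL κ Φ t p D g f) (vL κ Φ t p D g f) (vβL κ Φ t p D g f))) = (3 * (((fcellsA κ Φ t p D g f).s 0 : ℕ) : ℤ)) * (prFA κ Φ t p D g f).D := by linear_combination 3 * e0
    have hsh := rdLo_zero_widen (lo := arrLoY3 κ Φ t p D g f mk) (hi := arrHiY3 κ Φ t p D g f mk) (lo' := (![arrLoY3 κ Φ t p D g f mk 0 - 2 * (nL κ Φ t p D g f : ℤ), arrLoY3 κ Φ t p D g f mk 1 - kgSL (nL κ Φ t p D g f) (ℓL κ Φ t p D g f) (hL κ Φ t p D g f)] : Site 2)) (hi' := (![arrHiY3 κ Φ t p D g f mk 0 + (nL κ Φ t p D g f : ℤ), arrHiY3 κ Φ t p D g f mk 1 + 1] : Site 2))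
      (A := Aof κ) (n := nL κ Φ t p D g f) (h := hL κ Φ t p D g f) (vα := vL κ Φ t p D g f) (vβ := vβL κ Φ t p D g f) (c₀' := (prFA κ Φ t p D g f).c₀) (c₁' := (prFA κ Φ t p D g f).c₁) (D := (prFA κ Φ t p D g f).D)
      (e := 3 * modulus (nL κ Φ t p D g f) (hL κ Φ t p D g f) (vL κ Φ t p D g f) (vβL κ Φ t p D g f)) (k := 3 * (((fcellsA κ Φ t p D g f).s 0 : ℕ) : ℤ)) hn1 hA0.le hDp hc₀.le ?_ hk
    · rw [hc, hb0]; unfold cmidY3; omega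
    · simp only [Matrix.cons_val_zero, Matrix.cons_val_one]
      have e1 : modulus (nL κ Φ t p D g f) (hL κ Φ t p D g f) (vL κ Φ t p D g f) (vβL κ Φ t p D g f) * (arrLoY3 κ Φ t p D g f mk 0 - 2 * (nL κ Φ t p D g f : ℤ)) = modulus (nL κ Φ t p D g f) (hL κ Φ t p D g f) (vL κ Φ t p D g f) (vβL κ Φ t p D g f) * arrLoY3 κ Φ t p D g f mk 0 - 2 * ((nL κ Φ t p D g f : ℤ) * modulus (nL κ Φ t p D g f) (hL κ Φ t p D g f) (vL κ Φ t p D g f) (vβL κ Φ t p D g f)) := by ring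
      have e2 : ((nL κ Φ t p D g f : ℤ) : ℤ) * (3 * modulus (nL κ Φ t p D g f) (hL κ Φ t p D g f) (vL κ Φ t p D g f) (vβL κ Φ t p D g f)) = 3 * ((nL κ Φ t p D g f : ℤ) * modulus (nL κ Φ t p D g f) (hL κ Φ t p D g f) (vL κ Φ t p D g f) (vβL κ Φ t p D g f)) := by ring
      rw [e1, e2]; linarith
  · have hk : (prFA κ Φ t p D g f).c₀ * (Aof κ * (2 * modulus (nL κ Φ t p D g f) (hL κ Φ t p D g f) (vL κ Φ t p D g f) (vβL κ Φ t p D g f))) = (2 * (((fcellsA κ Φ t p D g f).s 0 : ℕ) : ℤ)) * (prFA κ Φ t p D g f).D := by linear_combination 2 * e0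
    have hsh := rdHi_zero_widen (lo := arrLoY3 κ Φ t p D g f mk) (hi := arrHiY3 κ Φ t p D g f mk) (lo' := (![arrLoY3 κ Φ t p D g f mk 0 - 2 * (nL κ Φ t p D g f : ℤ), arrLoY3 κ Φ t p D g f mk 1 - kgSL (nL κ Φ t p D g f) (ℓL κ Φ t p D g f) (hL κ Φ t p D g f)] : Site 2)) (hi' := (![arrHiY3 κ Φ t p D g f mk 0 + (nL κ Φ t p D g f : ℤ), arrHiY3 κ Φ t p D g f mk 1 + 1] : Site 2))
      (A := Aof κ) (n := nL κ Φ t p D g f) (h := hL κ Φ t p D g f) (vα := vL κ Φ t p D g f) (vβ := vβL κ Φ t p D g f) (c₀' := (prFA κ Φ t p D g f).c₀) (c₁' := (prFA κ Φ t p D g f).c₁) (D := (prFA κ Φ t p D g f).D)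
      (e := 2 * modulus (nL κ Φ t p D g f) (hL κ Φ t p D g f) (vL κ Φ t p D g f) (vβL κ Φ t p D g f)) (k := 2 * (((fcellsA κ Φ t p D g f).s 0 : ℕ) : ℤ)) hn1 hA0.le hDp hc₀.le ?_ hk
    · rw [hc, hb0]; unfold cmidY3; omega
    · simp only [Matrix.cons_val_zero, Matrix.cons_val_one]
      have e1 : modulus (nL κ Φ t p D g f) (hL κ Φ t p D g f) (vL κ Φ t p D g f) (vβL κ Φ t p D g f) * (arrHiY3 κ Φ t p D g f mk 0 + (nL κ Φ t p D g f : ℤ)) = modulus (nL κ Φ t p D g f) (hL κ Φ t p D g f) (vL κ Φ t p D g f) (vβL κ Φ t p D g f) * arrHiY3 κ Φ t p D g f mk 0 + (nL κ Φ t p D g f : ℤ) * modulus (nL κ Φ t p D g f) (hL κ Φ t p D g f) (vL κ Φ t p D g f) (vβL κ Φ t p D g f) := by ring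
      have e2 : ((nL κ Φ t p D g f : ℤ) : ℤ) * (2 * modulus (nL κ Φ t p D g f) (hL κ Φ t p D g f) (vL κ Φ t p D g f) (vβL κ Φ t p D g f)) = 2 * ((nL κ Φ t p D g f : ℤ) * modulus (nL κ Φ t p D g f) (hL κ Φ t p D g f) (vL κ Φ t p D g f) (vβL κ Φ t p D g f)) := by ring
      rw [e1, e2]; linarith

/-- **(R-YA) THE WIDENED ROOT y′ ARRIVAL BOX READS INSIDE `TargetFoot (1,true)` at `b = small3`, creep `c1 = cRvY3 mk`** (p3-g18's `hrow` of `KS.hlastf_RY`,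
box = `KS.yLast_mem_box`'s `kgLastLoY/HiY − (2n_L, sL) / + (n_L, 1)` at the (C) rows `kgYRows0_of … qxYQ4 WxYQ4`, `N := kgNYv0`, by `rfl` = `arrLoY3/arrHiY3`).
[this work] -/
theorem rootReadYA_Q (κ : Consts) {V : Type} [DecidableEq V] [Countable V] {G : SimpleGraph V} [G.LocallyFinite] (Φ : PlanarSkeletonFrmFrom G) (t : V) (p : unitInterval) (D : Skelφ.StepI.DataNS V) (g : ℕ) (f : ℕ) (mk : ℕ) (hKq : 5 ≤ Neg.Kq κ) (hN : EqNumL κ Φ t p D g f) (hg : gFloorKG κ Φ t p D mk ≤ g) (hg2 : 40 * Neg.K κ * KS0.R'0 κ Φ t p D mk ≤ g) :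
    ((cRvY3 κ Φ t p D g f mk : ℕ) : ℤ) - ((BSlot.small3 κ Φ t p D g f 0 : ℕ) : ℤ) + 1 ≤ rdLo (Aof κ) (nL κ Φ t p D g f) (hL κ Φ t p D g f) (vL κ Φ t p D g f) (vβL κ Φ t p D g f) (prFA κ Φ t p D g f).c₀ (prFA κ Φ t p D g f).c₁ (prFA κ Φ t p D g f).D (![arrLoY3 κ Φ t p D g f mk 0 - 2 * (nL κ Φ t p D g f : ℤ), arrLoY3 κ Φ t p D g f mk 1 - kgSL (nL κ Φ t p D g f) (ℓL κ Φ t p D g f) (hL κ Φ t p D g f)] : Site 2) (![arrHiY3 κ Φ t p D g f mk 0 + (nL κ Φ t p D g f : ℤ), arrHiY3 κ Φ t p D g f mk 1 + 1] : Site 2) 0 ∧ rdHi (Aof κ) (nL κ Φ t p D g f) (hL κ Φ t p D g f) (vL κ Φ t p D g f) (vβL κ Φ t p D g f) (prFA κ Φ t p D g f).c₀ (prFA κ Φ t p D g f).c₁ (prFA κ Φ t p D g f).D (![arrLoY3 κ Φ t p D g f mk 0 - 2 * (nL κ Φ t p D g f : ℤ), arrLoY3 κ Φ t p D g f mk 1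 - kgSL (nL κ Φ t p D g f) (ℓL κ Φ t p D g f) (hL κ Φ t p D g f)] : Site 2) (![arrHiY3 κ Φ t p D g f mk 0 + (nL κ Φ t p D g f : ℤ), arrHiY3 κ Φ t p D g f mk 1 + 1] : Site 2) 0 ≤ ((cRvY3 κ Φ t p D g f mk : ℕ) : ℤ) + ((BSlot.small3 κ Φ t p D g f 0 : ℕ) : ℤ) - 1 ∧
      20 * (((fcellsA κ Φ t p D g f).r 1 : ℕ) : ℤ) - ((BSlot.small3 κ Φ t p D g f 1 : ℕ) : ℤ) + 1 ≤ rdLo (Aof κ) (nL κ Φ t p D g f) (hL κ Φ t p D g f) (vL κ Φ t p D g f) (vβL κ Φ t p D g f) (prFA κ Φ t p D g f).c₀ (prFA κ Φ t p D g f).c₁ (prFA κ Φ t p D g f).D (![arrLoY3 κ Φ t p D g f mk 0 - 2 * (nL κ Φ t p D g f : ℤ), arrLoY3 κ Φ t p D g f mk 1 - kgSL (nL κ Φ t p D g f) (ℓL κ Φ t p D g f) (hL κ Φ t p D g f)] : Site 2) (![arrHiY3 κ Φ t p D g f mk 0 + (nL κ Φ t p D g f : ℤ), arrHiY3 κ Φ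 t p D g f mk 1 + 1] : Site 2) 1 ∧ rdHi (Aof κ) (nL κ Φ t p D g f) (hL κ Φ t p D g f) (vL κ Φ t p D g f) (vβL κ Φ t p D g f) (prFA κ Φ t p D g f).c₀ (prFA κ Φ t p D g f).c₁ (prFA κ Φ t p D g f).D (![arrLoY3 κ Φ t p D g f mk 0 - 2 * (nL κ Φ t p D g f : ℤ), arrLoY3 κ Φ t p D g f mk 1 - kgSL (nL κ Φ t p D g f) (ℓL κ Φ t p D g f) (hL κ Φ t p D g f)] : Site 2) (![arrHiY3 κ Φ t p D g f mk 0 + (nL κ Φ t p D g f : ℤ), arrHiY3 κ Φ t p D g f mk 1 + 1] : Site 2) 1 ≤ 20 * (((fcellsA κ Φ t p D g f).r 1 : ℕ) : ℤ) + ((BSlot.small3 κ Φ t p D g f 1 : ℕ) : ℤ) - 1 := by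
  obtain ⟨h1, h2⟩ := rootReadYA_across κ Φ t p D g f mk hKq hN hg hg2
  obtain ⟨h3, h4⟩ := rootReadYA_rows κ Φ t p D g f mk hKq hN hg hg2
  exact ⟨h1, h2, h3, h4⟩

end RootYA

end NegB

end PlanarSkeletonFrmFrom

end Summit.CriticalPhenomena.PercolationContinuityZ3.Theorems.Transplant

end
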